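import Literature.Computability.AlgebraicComplexity.GrenetEquivariant
import Literature.Computability.AlgebraicComplexity.GrenetProjection
import HarnessLib

/-!
# Cells of Grenet's adjacency matrix

Topic `Literature/Computability/AlgebraicComplexity`.  Companion of `GrenetEquivariant.lean`
(`Grenet.adj k n`, the weighted adjacency matrix of Grenet's branching program on the subsets of
`Fin n`: the arc `S → insert j S`, `j ∉ S`, carries the variable `X (j, |S|)`) and of
`GrenetProjection.lean` (`Grenet.adj_apply_self`, `Grenet.adj_apply_eq_zero_or_eq_X`).  This file
records the elementary CELL CALCULUS of `adj` (and of `1 - adj`, whose `(univ, ∅)` minor is Grenet's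
matrix) that is used whenever Grenet's matrix is modified by explicit row and column operations
(twists, purifications): which cells vanish, which variable sits on an arc, and which variables can
occur in a given row.

## Content (no definitions)

* `Grenet.adj_apply_insert`, `Grenet.adj_apply_insert_of_val_eq`, `Grenet.adj_empty_singleton` —
  the arc cells: `adj S (insert j S) = X (j, |S|)` for `j ∉ S`, `adj ∅ {j} = X (j, 0)`;
* `Grenet.adj_apply_of_forall_ne`, `Grenet.adj_apply_of_card_ne`,
  `Grenet.adj_apply_of_mem_of_notMem` — `adj S T = 0` off the arcs, in particular unless
  `|T| = |S| + 1` and unless `S ⊆ T`;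
* `Grenet.adj_apply_eq_zero_or_eq_X_card` — every cell of the row `S` is `0` or some `X (j, |S|)`;
* `Grenet.coeff_adj_apply_of_ne` — hence a variable `X (i, c)` with `c ≠ |S|` does not occur in the
  row `S`;
* `Grenet.neg_adj_apply_isPure` — `-adj S T` is `-X v` or a constant (the honest-cell shape);
* `Grenet.one_sub_adj_apply` — `(1 - adj) S T = [S = T] - adj S T`.

## Sources

* B. Grenet, *An upper bound for the permanent versus determinant problem*, manuscript (2011),
  Thm. 1 (key `Grenet2011`) — the branching program on the hypercube and its arc weights.
-/

noncomputable section

open MvPolynomial Matrix Finset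

namespace Literature.Computability.AlgebraicComplexity

namespace Grenet

variable (k : Type*) [CommRing k] {n : ℕ}

/-- **The arc cell.** For `j ∉ S` the cell `(S, insert j S)` of Grenet's adjacency matrix is the
single variable `X (j, |S|)` (the arc `S → insert j S` determines `j`). [cite: Grenet2011, Thm. 1] -/
theorem adj_apply_insert {S : Finset (Fin n)} {j : Fin n} (hj : j ∉ S) :
    adj k n S (insert j S) = X (j, ⟨S.card, card_lt_of_notMem hj⟩) := by
  rw [adj_apply, Fintype.sum_eq_single j]
  · rw [if_pos ⟨hj, rfl⟩, wt, dif_pos (card_lt_of_notMem hj)]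
  · intro j' hj'
    refine if_neg ?_
    rintro ⟨hj'S, hins⟩
    have hmem : j' ∈ insert j' S := mem_insert_self j' S
    rw [← hins] at hmem
    rcases mem_insert.mp hmem with h | h
    · exact hj' h
    · exact hj'S h

/-- The arc cell with the level written as any `c : Fin n` of value `|S|`:
`adj S (insert j S) = X (j, c)` for `j ∉ S`. [cite: Grenet2011, Thm. 1] -/
theorem adj_apply_insert_of_val_eq {S : Finset (Fin n)} {j : Fin n} (hj : j ∉ S) (c : Fin n)
    (hc : (c : ℕ) = S.card) : adj k n S (insert j S) = X (j, c) := by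
  rw [adj_apply_insert k hj]
  congr 2
  exact Fin.ext hc.symm

/-- The level-`0` arcs leave the source `∅`: `adj ∅ {j} = X (j, 0)`. [cite: Grenet2011, Thm. 1] -/
theorem adj_empty_singleton [NeZero n] (j : Fin n) :
    adj k n ∅ {j} = X (j, 0) := by
  rw [← insert_empty_eq j]
  exact adj_apply_insert_of_val_eq k (notMem_empty j) 0 (by rw [Fin.val_zero, card_empty])

/-- Off the arcs the cells of Grenet's adjacency matrix vanish: if `T` is not of the form
`insert j S` with `j ∉ S` then `adj S T = 0`. [cite: Grenet2011, Thm. 1] -/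
theorem adj_apply_of_forall_ne {S T : Finset (Fin n)} (h : ∀ j, j ∉ S → T ≠ insert j S) :
    adj k n S T = 0 := by
  rw [adj_apply]
  exact sum_eq_zero fun j _ => if_neg fun hj => h j hj.1 hj.2

/-- The arcs of Grenet's branching program raise the cardinality by one: `adj S T = 0` unless
`|T| = |S| + 1`. [cite: Grenet2011, Thm. 1] -/
theorem adj_apply_of_card_ne {S T : Finset (Fin n)} (h : T.card ≠ S.card + 1) :
    adj k n S T = 0 :=
  adj_apply_of_forall_ne k fun j hj hT => h (by rw [hT, card_insert_of_notMem hj])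

/-- The arcs of Grenet's branching program are inclusions: `adj S T = 0` as soon as some element of
`S` is missing from `T`. [cite: Grenet2011, Thm. 1] -/
theorem adj_apply_of_mem_of_notMem {S T : Finset (Fin n)} {a : Fin n} (haS : a ∈ S)
    (haT : a ∉ T) : adj k n S T = 0 :=
  adj_apply_of_forall_ne k fun j _ hT => haT (by rw [hT]; exact mem_insert_of_mem haS)

/-- Every cell of the row `S` of Grenet's adjacency matrix is `0` or a variable `X (j, |S|)` of
LEVEL `|S|`. [cite: Grenet2011, Thm. 1] -/
theorem adj_apply_eq_zero_or_eq_X_card (S T : Finset (Fin n)) :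
    adj k n S T = 0 ∨ ∃ (j : Fin n) (h : S.card < n), adj k n S T = X (j, ⟨S.card, h⟩) := by
  by_cases h : ∃ j, j ∉ S ∧ T = insert j S
  · obtain ⟨j, hj, rfl⟩ := h
    exact Or.inr ⟨j, card_lt_of_notMem hj, adj_apply_insert k hj⟩
  · exact Or.inl (adj_apply_of_forall_ne k fun j hj hT => h ⟨j, hj, hT⟩)

/-- Hence a variable `X (i, c)` of level `c ≠ |S|` does not occur in the row `S` of Grenet's
adjacency matrix: its coefficient in every cell `adj S T` is `0`. [cite: Grenet2011, Thm. 1] -/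
theorem coeff_adj_apply_of_ne (S T : Finset (Fin n)) {v : Fin n × Fin n}
    (hv : (v.2 : ℕ) ≠ S.card) :
    MvPolynomial.coeff (Finsupp.single v 1) (adj k n S T) = 0 := by
  rcases adj_apply_eq_zero_or_eq_X_card k S T with h | ⟨j, hS, h⟩
  · rw [h, coeff_zero]
  · rw [h, coeff_X, if_neg]
    intro heq
    rw [Finsupp.single_left_inj one_ne_zero] at heq
    exact hv (by rw [← heq])

/-- The honest-cell shape of `-adj`: every cell `-adj S T` is `-X v` for a variable `v` or a
constant (namely `0`). [cite: Grenet2011, Thm. 1] -/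
theorem neg_adj_apply_isPure (S T : Finset (Fin n)) :
    (∃ v, -adj k n S T = -X v) ∨ ∃ c, -adj k n S T = C c := by
  rcases adj_apply_eq_zero_or_eq_X k n S T with h | ⟨v, h⟩
  · exact Or.inr ⟨0, by rw [h, neg_zero, map_zero]⟩
  · exact Or.inl ⟨v, by rw [h]⟩

/-- The cells of `1 - adj` (whose `(univ, ∅)` minor is Grenet's matrix):
`(1 - adj) S T = [S = T] - adj S T`. [cite: Grenet2011, Thm. 1] -/
theorem one_sub_adj_apply (S T : Finset (Fin n)) :
    (1 - adj k n) S T = (if S = T then 1 else 0) - adj k n S T := by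
  rw [Matrix.sub_apply, Matrix.one_apply]

end Grenet

end Literature.Computability.AlgebraicComplexity
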